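import Summits.AnomalousDissipation.AnomalousDissipation.Theorems.SolenoidalFractalHomogenisationLagrangianStepVmodLossAdjDuality
import HarnessLib

/-!
# K1L_D (stmt-AnomalousDissipation-27980), (ℓ3-A) road A, (S2-fwd) glue: the ENERGY-ACCOUNTING SKELETON of RULING D28-26 (2) (option 1) —
# «dissipation ≥ κ·(energy − slow energy)» + «slow energy ≤ ε·loss» ⇒ `lossFwd (U s t) x ≥ min 1 (2κ(t−s)) · ‖x‖² / (2+ε)`
(helper; `--supports 27980 --as helper`; prover ad-k1loc-p3 g12.)

CONVENTION (D28-8′): derivative-index distortion `Torus.Visc4.conj`; constraint `∇·(G v) = 0`.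

RULING D28-26 (2) fixes the road for the (S2-fwd) loss LOWER bound of the distorted coarse member on FAST data: never test the high modes; account
for the slow block only (corrected slow tests, (S1)) and get the fast loss from the TOTAL energy identity `hEnergy : EnergyIdG …` (p726383):
(iii) «fast part ≥ dissipated at rate ≥ 2·lo′·a(n/4)² modulo the O(θ²)·loss source».  This file is step (iii) as a THEOREM with the two analytic
inputs as hypotheses on real functions — the (S2-fwd) prover supplies (b)+(c) coercivity + fast Poincaré `D(σ) ≥ κ·(‖w σ‖² − E_slow(σ))` and
(d) the slow-energy accounting `E_slow(σ) ≤ ε·lossFwd(σ)`, merged into the single a.e. hypothesis `κ·(‖x‖² − (1+ε)·q(σ)) ≤ D(σ)`, `q` = loss so far: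
* §1 **`loss_ge_of_accounting`** (pure real analysis): if `q τ = 2∫_{(0,τ]} D`, `D` integrable on `(0,τ]`, `q s ≤ q τ` for `s ∈ (0,τ]` and
  `κ(e₀ − (1+ε) q s) ≤ D s` a.e. on `(0,τ)` (`κ ≥ 0`, `1+ε ≥ 0`), then `2κτ·e₀/(1 + 2κ(1+ε)τ) ≤ q τ` (monotone comparison: no derivative, no
  Grönwall); `min_le_ratio` turns it into `min 1 (2κτ)·e₀/(2+ε) ≤ q τ` — the shape `min 1 (rate·t)` of the row texts;
* §2 **`lossFwd_mono_right`**: `lossFwd (U s t') x ≤ lossFwd (U s t) x` for `s ≤ t' ≤ t ≤ Tw` (cocycle + contraction of `IsDistortedPropagator`);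
* §3 **`EnergyIdG.exists_witness_lossFwd_ge_of_accounting`** (CONSUMER INTERFACE): under `hE : EnergyIdG Tw 𝔹₀ b G U`, a distorted propagator `U`
  and jointly continuous frame entries, for a base time `s` and a `G(s)`-solenoidal `x` — the forward witness `(w, Dw)`, its dissipation density
  `D(σ) = ∫ Σ 𝔹₀^{G(s+σ)} (Dw σ)(Dw σ)` INTEGRABLE on `(0, Tw−s)`, the loss formula, and: for every `t ∈ [s,Tw)`, IF `κ(‖x‖² − (1+ε)·lossFwd (U s (s+σ)) x) ≤ D(σ)`
  for a.e. `σ ∈ (0, t−s)` THEN `min 1 (2κ(t−s))·‖x‖²/(2+ε) ≤ lossFwd (U s t) x`.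
`sorry`-free; NOT a proof of (b)(c)(d), of any block, of K1L_D or of AD; rung F-D1.A0.
-/

set_option linter.dupNamespace false

noncomputable section

namespace Summit.AnomalousDissipation.AnomalousDissipation.Theorems.SolenoidalFractalHomogenisation.LagrangianStep.VmodDist

open Literature.Analysis Literature.Analysis.FluidPDE Literature.Analysis.FunctionSpaces
open MeasureTheory Set Filter Function
open scoped ENNReal NNReal InnerProductSpace
open Summit.AnomalousDissipation.AnomalousDissipation.Theorems.SolenoidalFractalHomogenisation.LagrangianStep.CellClauseMod
open Summit.AnomalousDissipation.AnomalousDissipation.Theorems.SolenoidalFractalHomogenisation.LagrangianStep.LossCurrency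

/-! ## §1 The accounting inequality (pure real analysis) -/

/-- **Monotone comparison for the accounted loss.**  `q τ = 2∫_{(0,τ]} D`, `D` integrable there, `q` does not exceed `q τ` on `(0,τ]`, and
`κ(e₀ − (1+ε) q s) ≤ D s` a.e. on `(0,τ)` with `κ ≥ 0`, `0 ≤ 1 + ε`, `0 ≤ τ`: then `2κτ·e₀/(1 + 2κ(1+ε)τ) ≤ q τ`. -/
theorem loss_ge_of_accounting {e₀ κ ε τ : ℝ} {D q : ℝ → ℝ} (hκ : 0 ≤ κ) (hε : 0 ≤ 1 + ε) (hτ : 0 ≤ τ)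
    (hq : q τ = 2 * ∫ s in Ioc 0 τ, D s) (hDi : IntegrableOn D (Ioc 0 τ) volume)
    (hmono : ∀ s ∈ Ioc 0 τ, q s ≤ q τ)
    (hacc : ∀ᵐ s ∂(volume.restrict (Ioo 0 τ)), κ * (e₀ - (1 + ε) * q s) ≤ D s) :
    2 * κ * τ * e₀ / (1 + 2 * κ * (1 + ε) * τ) ≤ q τ := by
  -- a.e. on `(0,τ]`: `κ(e₀ − (1+ε) q τ) ≤ D s`
  have hacc' : ∀ᵐ s ∂(volume.restrict (Ioc 0 τ)), κ * (e₀ - (1 + ε) * q τ) ≤ D s := by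
    rw [← Measure.restrict_congr_set Ioo_ae_eq_Ioc]
    filter_upwards [hacc, ae_restrict_mem measurableSet_Ioo] with s hs hsm
    have hm := hmono s ⟨hsm.1, hsm.2.le⟩
    have : κ * (e₀ - (1 + ε) * q τ) ≤ κ * (e₀ - (1 + ε) * q s) :=
      mul_le_mul_of_nonneg_left (by nlinarith [mul_le_mul_of_nonneg_left hm hε]) hκ
    exact this.trans hs
  have hconst : ∫ s in Ioc 0 τ, κ * (e₀ - (1 + ε) * q τ) = τ * (κ * (e₀ - (1 + ε) * q τ)) := by
    rw [setIntegral_const, Measure.real, Real.volume_Ioc, sub_zero, ENNReal.toReal_ofReal hτ, smul_eq_mul]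
  have hle : ∫ s in Ioc 0 τ, κ * (e₀ - (1 + ε) * q τ) ≤ ∫ s in Ioc 0 τ, D s :=
    setIntegral_mono_ae_restrict (integrableOn_const (measure_Ioc_lt_top.ne)) hDi hacc'
  rw [hconst] at hle
  have hden : 0 < 1 + 2 * κ * (1 + ε) * τ := by positivity
  rw [div_le_iff₀ hden]
  nlinarith [hle, hq]

/-- `min 1 a / (2 + ε) ≤ a / (1 + (1+ε)·a)` for `a ≥ 0`, `1 + ε ≥ 0` (the `min 1 (rate·t)` reading of the accounting bound). -/
theorem min_div_le_ratio {a ε : ℝ} (ha : 0 ≤ a) (hε : 0 ≤ 1 + ε) : min 1 a / (2 + ε) ≤ a / (1 + (1 + ε) * a) := by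
  have hden : 0 < 1 + (1 + ε) * a := by positivity
  have h2 : 0 < 2 + ε := by linarith
  rw [div_le_div_iff₀ h2 hden]
  rcases le_total a 1 with h | h
  · rw [min_eq_right h]; nlinarith [mul_nonneg hε ha, mul_le_mul_of_nonneg_left h (mul_nonneg hε ha)]
  · rw [min_eq_left h]; nlinarith [mul_nonneg hε ha]

/-- The accounting bound in the `min 1 (rate·t)` shape: `min 1 (2κτ) · e₀ / (2+ε) ≤ q τ` (`e₀ ≥ 0`). -/
theorem loss_ge_min_of_accounting {e₀ κ ε τ : ℝ} {D q : ℝ → ℝ} (hκ : 0 ≤ κ) (hε : 0 ≤ 1 + ε) (hτ : 0 ≤ τ) (he₀ : 0 ≤ e₀)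
    (hq : q τ = 2 * ∫ s in Ioc 0 τ, D s) (hDi : IntegrableOn D (Ioc 0 τ) volume)
    (hmono : ∀ s ∈ Ioc 0 τ, q s ≤ q τ)
    (hacc : ∀ᵐ s ∂(volume.restrict (Ioo 0 τ)), κ * (e₀ - (1 + ε) * q s) ≤ D s) :
    min 1 (2 * κ * τ) * e₀ / (2 + ε) ≤ q τ := by
  have h := loss_ge_of_accounting hκ hε hτ hq hDi hmono hacc
  have hm := min_div_le_ratio (a := 2 * κ * τ) (by positivity) hε
  calc min 1 (2 * κ * τ) * e₀ / (2 + ε) = min 1 (2 * κ * τ) / (2 + ε) * e₀ := by ring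
    _ ≤ 2 * κ * τ / (1 + (1 + ε) * (2 * κ * τ)) * e₀ := mul_le_mul_of_nonneg_right hm he₀
    _ = 2 * κ * τ * e₀ / (1 + 2 * κ * (1 + ε) * τ) := by ring
    _ ≤ q τ := h

/-! ## §2 The forward loss is monotone in the window end -/

variable {Tw : ℝ} {𝔹₀ : Torus.Visc4 (Fin 3)} {b : ℝ → VF} {G : ℝ → UnitAddTorus (Fin 3) → Matrix (Fin 3) (Fin 3) ℝ}
  {U : ℝ → ℝ → (V2 →L[ℝ] V2)}

/-- **`lossFwd (U s t') x ≤ lossFwd (U s t) x` for `0 ≤ s ≤ t' ≤ t ≤ Tw`** (cocycle `U t' t ∘ U s t' = U s t` and contraction). -/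
theorem lossFwd_mono_right (hU : IsDistortedPropagator Tw 𝔹₀ b G U) {s t' t : ℝ} (hs : 0 ≤ s) (hst' : s ≤ t') (ht't : t' ≤ t) (htT : t ≤ Tw)
    (x : V2) : lossFwd (U s t') x ≤ lossFwd (U s t) x := by
  unfold lossFwd
  have h := loss_le_loss_comp (T₁ := U s t') (T₂ := U t' t) (hU.norm_le t' t) x
  rw [ContinuousLinearMap.comp_apply, hU.comp s t' t hs hst' ht't htT x] at h
  exact h

/-! ## §3 The consumer interface over `EnergyIdG` -/

/-- **(S2-fwd) CONSUMER INTERFACE (step (iii) of D28-26 (2)).**  Under `hE : EnergyIdG Tw 𝔹₀ b G U`, a distorted propagator `U` and jointly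
continuous frame entries, for a base time `0 ≤ s < Tw` and a `G(s)`-solenoidal datum `x`: the forward witness `(w, Dw)` with its dissipation density
`D(σ) = ∫ Σ 𝔹₀^{G(s+σ)} (Dw σ)(Dw σ)` INTEGRABLE on `(0, Tw − s)`, the loss formula `lossFwd (U s t) x = 2∫_{(0,t−s]} D` on `[s,Tw)`, and the
accounting rule: for every `t ∈ [s,Tw)`, `κ ≥ 0`, `1+ε ≥ 0`, IF `κ·(‖x‖² − (1+ε)·lossFwd (U s (s+σ)) x) ≤ D(σ)` for a.e. `σ ∈ (0,t−s)` THEN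
`min 1 (2κ(t−s)) · ‖x‖² / (2+ε) ≤ lossFwd (U s t) x`. -/
theorem EnergyIdG.exists_witness_lossFwd_ge_of_accounting (hE : EnergyIdG Tw 𝔹₀ b G U) (hU : IsDistortedPropagator Tw 𝔹₀ b G U)
    (hGc : ∀ i j, Continuous (uncurry fun t y => G t y i j))
    {s : ℝ} (hs : 0 ≤ s) (hsT : s < Tw) (x : V2) (hx : Torus.IsWeaklyDivFree (Torus.distort (G s) ((x : V2) : VF))) :
    ∃ (w : ℝ → VF) (Dw : ℝ → Fin 3 → VF),
      Torus.IsWeakTensorPassiveVectorDistortedOn 0 (Tw - s) 𝔹₀ (fun τ => b (s + τ)) (fun τ => G (s + τ)) ((x : V2) : VF) w ∧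
      (∀ c, MemLp (uncurry (Dw · c)) 2 (((volume : Measure ℝ).restrict (Ioo 0 (Tw - s))).prod volume)) ∧
      (∀ᵐ τ ∂(volume.restrict (Ioo 0 (Tw - s))), ∀ c, Torus.HasWeakPartialDeriv c (w τ) (Dw τ c)) ∧
      IntegrableOn (fun σ => ∫ y, ∑ l, ∑ i, ∑ c, ∑ e,
        Torus.Visc4.conj (G (s + σ) y) 𝔹₀ i c l e * (Dw σ c y) i * (Dw σ e y) l) (Ioo 0 (Tw - s)) volume ∧
      (∀ t ∈ Ico s Tw, lossFwd (U s t) x =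
        2 * ∫ σ in Ioc 0 (t - s), ∫ y, ∑ l, ∑ i, ∑ c, ∑ e, Torus.Visc4.conj (G (s + σ) y) 𝔹₀ i c l e * (Dw σ c y) i * (Dw σ e y) l) ∧
      ∀ t ∈ Ico s Tw, ∀ κ ε : ℝ, 0 ≤ κ → 0 ≤ 1 + ε →
        (∀ᵐ σ ∂(volume.restrict (Ioo 0 (t - s))),
          κ * (‖x‖ ^ 2 - (1 + ε) * lossFwd (U s (s + σ)) x)
            ≤ ∫ y, ∑ l, ∑ i, ∑ c, ∑ e, Torus.Visc4.conj (G (s + σ) y) 𝔹₀ i c l e * (Dw σ c y) i * (Dw σ e y) l) →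
        min 1 (2 * κ * (t - s)) * ‖x‖ ^ 2 / (2 + ε) ≤ lossFwd (U s t) x := by
  obtain ⟨w, Dw, hcl, hM, hD, hEq⟩ := hE s hs hsT x hx
  have h𝔅c : ∀ i c l e, Continuous (uncurry fun σ y => Torus.Visc4.conj (G (s + σ) y) 𝔹₀ i c l e) := by
    intro i c l e
    have hGc' : ∀ i j, Continuous (uncurry fun σ y => G (s + σ) y i j) := fun i j =>
      (hGc i j).comp ((continuous_const.add continuous_fst).prodMk continuous_snd)
    exact Torus.continuous_uncurry_conj_entry hGc' _ i c l e
  have hDi := integrableOn_dissipation h𝔅c hM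
  have hloss : ∀ t ∈ Ico s Tw, lossFwd (U s t) x =
      2 * ∫ σ in Ioc 0 (t - s), ∫ y, ∑ l, ∑ i, ∑ c, ∑ e, Torus.Visc4.conj (G (s + σ) y) 𝔹₀ i c l e * (Dw σ c y) i * (Dw σ e y) l := by
    intro t ht; unfold lossFwd; rw [hEq t ht]; ring
  refine ⟨w, Dw, hcl, hM, hD, hDi, hloss, fun t ht κ ε hκ hε hacc => ?_⟩
  have hts : 0 ≤ t - s := by linarith [ht.1]
  -- the loss so far as a function of the elapsed time
  have key := loss_ge_min_of_accounting (q := fun σ => lossFwd (U s (s + σ)) x) (e₀ := ‖x‖ ^ 2) (τ := t - s) hκ hε hts (sq_nonneg _)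
    (by have h := hloss t ht; rwa [show s + (t - s) = t by ring])
    (by rw [integrableOn_Ioc_iff_integrableOn_Ioo]; exact hDi.mono_set (Ioo_subset_Ioo le_rfl (by linarith [ht.2])))
    (fun σ hσ => lossFwd_mono_right hU hs (by linarith [hσ.1]) (by linarith [hσ.2]) (by linarith [ht.2]) x)
    hacc
  simpa only [show s + (t - s) = t by ring] using key

end Summit.AnomalousDissipation.AnomalousDissipation.Theorems.SolenoidalFractalHomogenisation.LagrangianStep.VmodDist

end
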